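import Summits.FinalStateConjecture.FinalStateConjecture.Theorems.EIHFluxBalanceInertialRecessionStubCoerMomKernelCovA
import Summits.FinalStateConjecture.FinalStateConjecture.Theorems.EIHFluxBalanceInertialRecessionSlavingFarFieldBoost

/-!
# Route EIHFluxBalance — `InertialRecession` (E′), line `SketchCleanExcision`, skeleton r13,
# stub `stub_coerMomKernel` (Bk), part 6b: the boosted Lense–Thirring scalar field under rest
# isometries — the spin vector is transported by the adjugate of the spatial block

Helper file for the crux `stmt-FinalStateConjecture-17403`
(`Summit.FinalStateConjecture.FinalStateConjecture.Theses.EIHFluxBalance.InertialRecession`, E′),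
registered stub `stub_coerMomKernel` (Bk) of skeleton r13 (seat 1).

The spin rows of Bk are fed to the far-field tables (…SlavingFarFieldSpinRowsA/B) through the scalar
Lense–Thirring form
`LT_σ(P; U, W) = (2/‖P⃗‖³)(ℓ_P(U) ⟪P⃗, σ × W⃗⟫ + ⟪P⃗, σ × U⃗⟫ ℓ_P(W))` with a FREE spin vector `σ`.
For a rest isometry `R` (`η`-isometry with `R e₀ = e₀`, spatial block `Q_{ij} = (R e_j)_i`):

* `bk_restMap_spatial_coord` — `(Rv)_i = Σⱼ Q_{ij} v_j` on spatial components;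
* **`bk_restMap_LT`** — `LT_σ(RP; RU, RW) = LT_{σ''}(P; U, W)` with `σ'' = adj(Q) σ`
  (`⟪Qp, σ × Qw⟫ = ⟪p, adj(Q)σ × w⟫`, a polynomial identity; `ℓ`, `‖·⃗‖` are `R`-invariant);
* **`bk_sigma_eq_zero_of_restMap_LT`** — if `LT_σ(RP; RU, RW)` vanishes identically and `R` has a
  right inverse then `σ = 0` (evaluate at `P = e₁, e₂`, `U = e₀`, `W = e₂, e₃`).

No definitions, no named facts, no `sorry`.
-/

set_option linter.dupNamespace false
set_option maxSynthPendingDepth 3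

noncomputable section

open Set Function Filter ContinuousLinearMap Literature.Geometry.Lorentzian
  Literature.Geometry.Lorentzian.Schwarzschild
open scoped Topology ContDiff InnerProductSpace

namespace Summit.FinalStateConjecture.FinalStateConjecture.Theorems.SublinearIsFree.Slaving

section RestMap

variable {R : E4 →L[ℝ] E4}
  (hiso : ∀ u w : E4, Minkowski.bilin (R u) (R w) = Minkowski.bilin u w)
  (h0 : R (E4.basisVector 0) = E4.basisVector 0)
include hiso h0

omit hiso in
/-- **Spatial components under a rest map**: `(Rv)_i = Σⱼ (Re_j)_i v_j` over the spatial
coordinates (`R e₀ = e₀` has no spatial part). [folklore] -/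
theorem bk_restMap_spatial_coord (v : E4) (i : Fin 3) :
    R v i.succ = R (E4.basisVector 1) i.succ * v 1 + R (E4.basisVector 2) i.succ * v 2
      + R (E4.basisVector 3) i.succ * v 3 := by
  conv_lhs => rw [QuasiStationarity.eq_sum_basisVector v]
  simp only [map_add, map_smul, h0, PiLp.add_apply, PiLp.smul_apply, smul_eq_mul]
  have : (E4.basisVector 0 : E4) i.succ = 0 := by simp [Fin.succ_ne_zero]
  rw [this]
  ring

set_option maxHeartbeats 1600000 in
/-- **The Lense–Thirring scalar field under a rest map.** With `Q_{ij} = (R e_j)_i` and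
`σ'' = adj(Q) σ`: `LT_σ(RP; RU, RW) = LT_{σ''}(P; U, W)` for all `P, U, W`. [folklore] -/
theorem bk_restMap_LT (σ₁ σ₂ σ₃ : ℝ) (P U W : E4) :
    2 / E4.spatialNorm (R P) ^ 3 *
        (ell (R P) (R U) * sdot (R P) (WithLp.toLp 2 ![(0 : ℝ), σ₂ * (R W) 3 - σ₃ * (R W) 2, σ₃ * (R W) 1 - σ₁ * (R W) 3, σ₁ * (R W) 2 - σ₂ * (R W) 1]) +
          sdot (R P) (WithLp.toLp 2 ![(0 : ℝ), σ₂ * (R U) 3 - σ₃ * (R U) 2, σ₃ * (R U) 1 - σ₁ * (R U) 3, σ₁ * (R U) 2 - σ₂ * (R U) 1]) * ell (R P) (R W))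
      = 2 / E4.spatialNorm P ^ 3 *
        (ell P U * sdot P (WithLp.toLp 2 ![(0 : ℝ),
            ((R (E4.basisVector 3) 2 * R (E4.basisVector 1) 3 - R (E4.basisVector 1) 2 * R (E4.basisVector 3) 3) * σ₁ + (R (E4.basisVector 1) 1 * R (E4.basisVector 3) 3 - R (E4.basisVector 3) 1 * R (E4.basisVector 1) 3) * σ₂ + (R (E4.basisVector 3) 1 * R (E4.basisVector 1) 2 - R (E4.basisVector 1) 1 * R (E4.basisVector 3) 2) * σ₃) * W 3
              - ((R (E4.basisVector 1) 2 * R (E4.basisVector 2) 3 - R (E4.basisVector 2) 2 * R (E4.basisVector 1) 3) * σ₁ + (R (E4.basisVector 2) 1 * R (E4.basisVector 1) 3 - R (E4.basisVector 1) 1 * R (E4.basisVector 2) 3) * σ₂ + (R (E4.basisVector 1) 1 * R (E4.basisVector 2) 2 - R (E4.basisVector 2) 1 * R (E4.basisVector 1) 2) * σ₃) * W 2,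
            ((R (E4.basisVector 1) 2 * R (E4.basisVector 2) 3 - R (E4.basisVector 2) 2 * R (E4.basisVector 1) 3) * σ₁ + (R (E4.basisVector 2) 1 * R (E4.basisVector 1) 3 - R (E4.basisVector 1) 1 * R (E4.basisVector 2) 3) * σ₂ + (R (E4.basisVector 1) 1 * R (E4.basisVector 2) 2 - R (E4.basisVector 2) 1 * R (E4.basisVector 1) 2) * σ₃) * W 1
              - ((R (E4.basisVector 2) 2 * R (E4.basisVector 3) 3 - R (E4.basisVector 3) 2 * R (E4.basisVector 2) 3) * σ₁ + (R (E4.basisVector 3) 1 * R (E4.basisVector 2) 3 - R (E4.basisVector 2) 1 * R (E4.basisVector 3) 3) * σ₂ + (R (E4.basisVector 2) 1 * R (E4.basisVector 3) 2 - R (E4.basisVector 3) 1 * R (E4.basisVector 2) 2) * σ₃) * W 3,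
            ((R (E4.basisVector 2) 2 * R (E4.basisVector 3) 3 - R (E4.basisVector 3) 2 * R (E4.basisVector 2) 3) * σ₁ + (R (E4.basisVector 3) 1 * R (E4.basisVector 2) 3 - R (E4.basisVector 2) 1 * R (E4.basisVector 3) 3) * σ₂ + (R (E4.basisVector 2) 1 * R (E4.basisVector 3) 2 - R (E4.basisVector 3) 1 * R (E4.basisVector 2) 2) * σ₃) * W 2
              - ((R (E4.basisVector 3) 2 * R (E4.basisVector 1) 3 - R (E4.basisVector 1) 2 * R (E4.basisVector 3) 3) * σ₁ + (R (E4.basisVector 1) 1 * R (E4.basisVector 3) 3 - R (E4.basisVector 3) 1 * R (E4.basisVector 1) 3) * σ₂ + (R (E4.basisVector 3) 1 * R (E4.basisVector 1) 2 - R (E4.basisVector 1) 1 * R (E4.basisVector 3) 2) * σ₃) * W 1]) +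
          sdot P (WithLp.toLp 2 ![(0 : ℝ),
            ((R (E4.basisVector 3) 2 * R (E4.basisVector 1) 3 - R (E4.basisVector 1) 2 * R (E4.basisVector 3) 3) * σ₁ + (R (E4.basisVector 1) 1 * R (E4.basisVector 3) 3 - R (E4.basisVector 3) 1 * R (E4.basisVector 1) 3) * σ₂ + (R (E4.basisVector 3) 1 * R (E4.basisVector 1) 2 - R (E4.basisVector 1) 1 * R (E4.basisVector 3) 2) * σ₃) * U 3
              - ((R (E4.basisVector 1) 2 * R (E4.basisVector 2) 3 - R (E4.basisVector 2) 2 * R (E4.basisVector 1) 3) * σ₁ + (R (E4.basisVector 2) 1 * R (E4.basisVector 1) 3 - R (E4.basisVector 1) 1 * R (E4.basisVector 2) 3) * σ₂ + (R (E4.basisVector 1) 1 * R (E4.basisVector 2) 2 - R (E4.basisVector 2) 1 * R (E4.basisVector 1) 2) * σ₃) * U 2,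
            ((R (E4.basisVector 1) 2 * R (E4.basisVector 2) 3 - R (E4.basisVector 2) 2 * R (E4.basisVector 1) 3) * σ₁ + (R (E4.basisVector 2) 1 * R (E4.basisVector 1) 3 - R (E4.basisVector 1) 1 * R (E4.basisVector 2) 3) * σ₂ + (R (E4.basisVector 1) 1 * R (E4.basisVector 2) 2 - R (E4.basisVector 2) 1 * R (E4.basisVector 1) 2) * σ₃) * U 1
              - ((R (E4.basisVector 2) 2 * R (E4.basisVector 3) 3 - R (E4.basisVector 3) 2 * R (E4.basisVector 2) 3) * σ₁ + (R (E4.basisVector 3) 1 * R (E4.basisVector 2) 3 - R (E4.basisVector 2) 1 * R (E4.basisVector 3) 3) * σ₂ + (R (E4.basisVector 2) 1 * R (E4.basisVector 3) 2 - R (E4.basisVector 3) 1 * R (E4.basisVector 2) 2) * σ₃) * U 3,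
            ((R (E4.basisVector 2) 2 * R (E4.basisVector 3) 3 - R (E4.basisVector 3) 2 * R (E4.basisVector 2) 3) * σ₁ + (R (E4.basisVector 3) 1 * R (E4.basisVector 2) 3 - R (E4.basisVector 2) 1 * R (E4.basisVector 3) 3) * σ₂ + (R (E4.basisVector 2) 1 * R (E4.basisVector 3) 2 - R (E4.basisVector 3) 1 * R (E4.basisVector 2) 2) * σ₃) * U 2
              - ((R (E4.basisVector 3) 2 * R (E4.basisVector 1) 3 - R (E4.basisVector 1) 2 * R (E4.basisVector 3) 3) * σ₁ + (R (E4.basisVector 1) 1 * R (E4.basisVector 3) 3 - R (E4.basisVector 3) 1 * R (E4.basisVector 1) 3) * σ₂ + (R (E4.basisVector 3) 1 * R (E4.basisVector 1) 2 - R (E4.basisVector 1) 1 * R (E4.basisVector 3) 2) * σ₃) * U 1]) * ell P W) := by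
  rw [bk_restMap_spatialNorm hiso h0, bk_restMap_ell hiso h0, bk_restMap_ell hiso h0]
  have hc := bk_restMap_spatial_coord h0
  have hP1 := hc P 0; have hP2 := hc P 1; have hP3 := hc P 2
  have hU1 := hc U 0; have hU2 := hc U 1; have hU3 := hc U 2
  have hW1 := hc W 0; have hW2 := hc W 1; have hW3 := hc W 2
  simp only [Fin.succ_zero_eq_one, Fin.succ_one_eq_two, show ((2 : Fin 3).succ : Fin 4) = 3 from rfl]
    at hP1 hP2 hP3 hU1 hU2 hU3 hW1 hW2 hW3
  simp only [sdot_eq, Matrix.cons_val_one, Matrix.cons_val_zero, Matrix.cons_val_two,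
    Matrix.cons_val, Matrix.head_cons, Matrix.tail_cons, hP1, hP2, hP3, hU1, hU2, hU3, hW1, hW2, hW3]
  ring

omit hiso h0 in
/-- **The spin vector is recovered from the transported field**: if `LT_σ(RP; RU, RW) = 0` for all
`P, U, W` and `R` has a right inverse, then `σ = 0`. [folklore] -/
theorem bk_sigma_eq_zero_of_restMap_LT {Rinv : E4 →L[ℝ] E4} (h1 : ∀ w : E4, R (Rinv w) = w)
    {σ₁ σ₂ σ₃ : ℝ}
    (h : ∀ P U W : E4, 2 / E4.spatialNorm (R P) ^ 3 *
        (ell (R P) (R U) * sdot (R P) (WithLp.toLp 2 ![(0 : ℝ), σ₂ * (R W) 3 - σ₃ * (R W) 2, σ₃ * (R W) 1 - σ₁ * (R W) 3, σ₁ * (R W) 2 - σ₂ * (R W) 1]) +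
          sdot (R P) (WithLp.toLp 2 ![(0 : ℝ), σ₂ * (R U) 3 - σ₃ * (R U) 2, σ₃ * (R U) 1 - σ₁ * (R U) 3, σ₁ * (R U) 2 - σ₂ * (R U) 1]) * ell (R P) (R W)) = 0) :
    σ₁ = 0 ∧ σ₂ = 0 ∧ σ₃ = 0 := by
  have hn1 : E4.spatialNorm (E4.basisVector 1) = 1 := by
    rw [spatialNorm_eq_sqrt]; simp
  have hn2 : E4.spatialNorm (E4.basisVector 2) = 1 := by
    rw [spatialNorm_eq_sqrt]; simp
  have k13 := h (Rinv (E4.basisVector 1)) (Rinv (E4.basisVector 0)) (Rinv (E4.basisVector 3))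
  have k12 := h (Rinv (E4.basisVector 1)) (Rinv (E4.basisVector 0)) (Rinv (E4.basisVector 2))
  have k23 := h (Rinv (E4.basisVector 2)) (Rinv (E4.basisVector 0)) (Rinv (E4.basisVector 3))
  simp only [h1] at k13 k12 k23
  simp only [ell, sdot_eq, hn1, hn2, Matrix.cons_val_one, Matrix.cons_val_zero,
    Matrix.cons_val_two, Matrix.cons_val, Matrix.head_cons, Matrix.tail_cons] at k13 k12 k23
  simp at k13 k12 k23
  refine ⟨?_, ?_, ?_⟩ <;> linarith

end RestMap

/-- **Registered carrier** `bk_covLT_carrier` of the crux item (one-line form of a lemma of this file,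
for the `--supports` protocol). [folklore] -/
theorem bk_covLT_carrier : open Literature.Geometry.Lorentzian in ∀ {R : E4 →L[ℝ] E4}, R (E4.basisVector 0) = E4.basisVector 0 → ∀ (v : E4) (i : Fin 3), R v i.succ = R (E4.basisVector 1) i.succ * v 1 + R (E4.basisVector 2) i.succ * v 2 + R (E4.basisVector 3) i.succ * v 3 :=
  fun h0 v i ↦ bk_restMap_spatial_coord h0 v i

end Summit.FinalStateConjecture.FinalStateConjecture.Theorems.SublinearIsFree.Slaving

end
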